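import Mathlib.LinearAlgebra.UnitaryGroup
import Mathlib.LinearAlgebra.Matrix.Kronecker
import Mathlib.Analysis.SpecialFunctions.Complex.Circle
import Mathlib.Analysis.Complex.Basic
import Mathlib.Topology.Instances.Matrix
import Mathlib.Logic.Encodable.Basic
import Mathlib.Logic.Equiv.Set
import Mathlib.Tactic.DeriveFintype
import Mathlib.Tactic.FinCases
import HarnessLib

-- provenance: harness21/H21/H21/Prelude/CryptoQuantFine/QubitRegister.lean @ a042e98 (interim HEAD d8f2665); M5 mechanical rewrite
/-!
# Qubit registers, gate placement and gate sets (trunk CryptoQuantFine, outline Q1)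

This prelude file realises the notion `qubit_gate_placement` of the CryptoQuantFine outline:

* an `n`-qubit register `QReg n := Fin n → Bool`, state vectors `QReg n → ℂ`, computational basis
  states, zero-padding of inputs and the tensor product of state vectors;
* `placeGate e U`: the `2^n × 2^n` matrix acting as the `k`-qubit gate `U` on the wires selected by
  an embedding `e : Fin k ↪ Fin n` and as the identity elsewhere;
* the standard named gates `hGate` (Hadamard), `sGate`, `tGate`, `pauliX`, `pauliZ`, `cnot`, `cz`,
  `toffoli`;
* gate sets `QGateSet` (an alphabet of operations with arities and matrices), the Clifford+T set
  `cliffordT` and the Toffoli+Hadamard set `toffoliH`;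
* the placement-level universality notion `QGateSet.IsUniversal` (density modulo global phase of
  the group generated by all placements, for all large `n`) and inverse-closedness.

## Sources

* M. A. Nielsen, I. L. Chuang, *Quantum Computation and Quantum Information* (2000), §4.2–4.5.
* P. O. Boykin, T. Mor, M. Pulver, V. Roychowdhury, F. Vatan, *On universal and fault-tolerant
  quantum computing* (FOCS 1999) — universality of Clifford+T.
* Y. Shi, *Both Toffoli and controlled-NOT need little help to do universal quantum computation*
  (2003) — Toffoli+Hadamard.

## Mathlib

Used: `Matrix.unitaryGroup`, `Matrix.kroneckerMap`/`⊗ₖ`, `Matrix.reindex`, `Matrix.of`, `Pi.single`,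
`Fin.append`, `Complex.exp`, `Subgroup.closure`, `Dense`, the matrix topology
(`Mathlib.Topology.Instances.Matrix`), `Equiv.Set.sumCompl`, `Equiv.sumArrowEquivProdArrow`,
`Equiv.ofInjective`. Mathlib has no qubit registers, quantum gates or gate placement
(searched: `qubit`, `hadamardGate`, `pauli`, `cnot`, `toffoli`); `Matrix.hadamard` is the
entrywise (Hadamard) *product*, hence the Hadamard gate is called `hGate` here.

## Design choices

* All gates are plain matrices; unitarity is a `Prop` (`QGateSet.IsUnitary`) proved separately, so
  that structures stay proof-free.
* Wire `0` of `cnot`/`cz`/`toffoli` is the (first) control; the last wire is the target.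
* `QGateSet.IsUniversal` is a *placement-level* notion and is deliberately different from the accepted
  `Literature.Computability.QuantumComplexity.IsUniversalGateSet` (Wave0), see its docstring.
-/

open Matrix
open scoped Kronecker

namespace Literature.Computability.Cryptography

/-! ### Registers and state vectors -/

/-- An `n`-qubit classical register (a computational-basis label): a Boolean string of length `n`.
State vectors of `n` qubits are functions `QReg n → ℂ`. (Nielsen–Chuang §4.1.) [folklore] -/
abbrev QReg (n : ℕ) : Type := Fin n → Bool

/-- The computational basis state `|x⟩` as a vector `QReg n → ℂ`. (Nielsen–Chuang §1.2.) [folklore] -/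
noncomputable def basisState {n : ℕ} (x : QReg n) : QReg n → ℂ := Pi.single x 1

/-- The all-zero basis state `|0…0⟩` on `n` qubits. (Nielsen–Chuang §4.1.) [folklore] -/
noncomputable def zeroState (n : ℕ) : QReg n → ℂ := basisState (fun _ => false)

/-- Pad an `n`-bit input with `m` ancilla bits initialised to `false` (`|x⟩ ↦ |x⟩|0^m⟩`).
(Nielsen–Chuang §4.5.) [folklore] -/
def padInput {n : ℕ} (x : QReg n) (m : ℕ) : QReg (n + m) := Fin.append x (fun _ => false)

/-- The tensor product `ψ ⊗ φ` of an `a`-qubit and a `b`-qubit state vector, as an `(a+b)`-qubit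
state vector: `(ψ ⊗ φ)(z) = ψ(z|_{first a}) · φ(z|_{last b})`. (Nielsen–Chuang §2.1.7.) [folklore] -/
def tensorVec {a b : ℕ} (ψ : QReg a → ℂ) (φ : QReg b → ℂ) : QReg (a + b) → ℂ :=
  fun z => ψ (fun i => z (Fin.castAdd b i)) * φ (fun j => z (Fin.natAdd a j))

/-- The squared `ℓ²`-norm `∑ₓ ‖ψ x‖²` of a state vector. (Nielsen–Chuang §2.2.5, Born rule.) [folklore] -/
noncomputable def normSq {n : ℕ} (ψ : QReg n → ℂ) : ℝ := ∑ x, ‖ψ x‖ ^ 2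

/-- Amplitudes of a basis state: `⟨y|x⟩ = [y = x]`. (Nielsen–Chuang §1.2.) [folklore] -/
@[simp]
theorem basisState_apply {n : ℕ} (x y : QReg n) :
    basisState x y = if y = x then 1 else 0 := by
  simp [basisState, Pi.single_apply]

/-- Basis states are unit vectors. (Nielsen–Chuang §2.2.5.) [folklore] -/
theorem normSq_basisState {n : ℕ} (x : QReg n) : normSq (basisState x) = 1 := by
  simp [normSq, basisState_apply, apply_ite norm, Finset.sum_ite_eq']

/-! ### Gate placement -/

/-- **Gate placement.** Given an embedding `e : Fin k ↪ Fin n` of wires and a `k`-qubit gate `U`,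
`placeGate e U` is the `n`-qubit operator acting as `U` on the wires `e 0, …, e (k-1)` and as the
identity on the remaining wires: its `(x, y)` entry is `U (x ∘ e) (y ∘ e)` if `x` and `y` agree
off the range of `e`, and `0` otherwise. (Nielsen–Chuang §4.2–4.3.) [folklore] -/
def placeGate {R : Type*} [CommRing R] {k n : ℕ} (e : Fin k ↪ Fin n)
    (U : Matrix (QReg k) (QReg k) R) : Matrix (QReg n) (QReg n) R :=
  Matrix.of fun x y => if (∀ i, i ∉ Set.range e → x i = y i) then U (x ∘ e) (y ∘ e) else 0

/-- Splitting the wires of an `n`-qubit register along an embedding `e : Fin k ↪ Fin n`: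
`QReg n ≃ QReg k × ((range e)ᶜ → Bool)`, `x ↦ (x ∘ e, x|_{(range e)ᶜ})`. Used to express
`placeGate` as a reindexed Kronecker product. (Nielsen–Chuang §4.3.) [folklore] -/
noncomputable def splitWires {k n : ℕ} (e : Fin k ↪ Fin n) :
    QReg n ≃ QReg k × (((Set.range e)ᶜ : Set (Fin n)) → Bool) := by
  classical
  exact ((Equiv.arrowCongr (Equiv.Set.sumCompl (Set.range e)) (Equiv.refl Bool)).symm.trans
    (Equiv.sumArrowEquivProdArrow _ _ Bool)).trans
    (Equiv.prodCongr (Equiv.arrowCongr (Equiv.ofInjective e e.injective).symm (Equiv.refl Bool))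
      (Equiv.refl _))

section placeGate

variable {R : Type*} [CommRing R] {k n : ℕ}

/-- Entries of a placed gate (definitional unfolding of `placeGate`). [folklore] -/
theorem placeGate_apply (e : Fin k ↪ Fin n) (U : Matrix (QReg k) (QReg k) R) (x y : QReg n) :
    placeGate e U x y =
      if (∀ i, i ∉ Set.range e → x i = y i) then U (x ∘ e) (y ∘ e) else 0 := rfl

/-- `placeGate e U` is the Kronecker product `U ⊗ₖ 1` transported along `splitWires e`.
(Nielsen–Chuang §4.3.) [cite: NielsenChuang2010, §4.3] -/
def placeGate_eq_reindex_kronecker : Prop :=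
  ∀ (e : Fin k ↪ Fin n) (U : Matrix (QReg k) (QReg k) R),
    placeGate e U =
      Matrix.reindex (splitWires e).symm (splitWires e).symm
        (U ⊗ₖ (1 : Matrix (((Set.range e)ᶜ : Set (Fin n)) → Bool)
          (((Set.range e)ᶜ : Set (Fin n)) → Bool) R))

/-- Placing a unitary gate yields a unitary operator. (Nielsen–Chuang §4.3.) [cite: NielsenChuang2010, §4.3] -/
def placeGate_mem_unitaryGroup : Prop :=
  ∀ [StarRing R] (e : Fin k ↪ Fin n) {U : Matrix (QReg k) (QReg k) R} (hU : U ∈ Matrix.unitaryGroup (QReg k) R),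
    placeGate e U ∈ Matrix.unitaryGroup (QReg n) R

/-- Placing the identity gate gives the identity. [folklore] -/
@[simp]
theorem placeGate_one (e : Fin k ↪ Fin n) :
    placeGate e (1 : Matrix (QReg k) (QReg k) R) = 1 := by
  ext x y
  simp only [placeGate_apply, Matrix.one_apply]
  by_cases hxy : x = y
  · subst hxy
    simp
  · simp only [hxy, if_false]
    split_ifs with h1 h2
    · refine absurd (funext fun i => ?_) hxy
      by_cases hi : i ∈ Set.range e
      · obtain ⟨j, rfl⟩ := hi
        exact congrFun h2 j
      · exact h1 i hi
    · rfl
    · rfl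

/-- Placement along fixed wires is multiplicative. (Nielsen–Chuang §4.2.) [cite: NielsenChuang2010, §4.2] -/
def placeGate_mul : Prop :=
  ∀ (e : Fin k ↪ Fin n) (U V : Matrix (QReg k) (QReg k) R),
    placeGate e (U * V) = placeGate e U * placeGate e V

/-- Gates placed on disjoint sets of wires commute. (Nielsen–Chuang §4.2.) [cite: NielsenChuang2010, §4.2] -/
def placeGate_comm_of_disjoint : Prop :=
  ∀ {k' : ℕ} (e : Fin k ↪ Fin n) (e' : Fin k' ↪ Fin n) (h : Disjoint (Set.range e) (Set.range e')) (U : Matrix (QReg k) (QReg k) R) (V : Matrix (QReg k') (QReg k') R),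
    placeGate e U * placeGate e' V = placeGate e' V * placeGate e U

/-- Entry formula for the product of two gates placed on disjoint wires: in
`(placeGate e U * placeGate e' V) x z = ∑_y …` only the intermediate register
`y₀ = (z on range e, x elsewhere)` contributes, so the entry is `U (x∘e) (z∘e) · V (x∘e') (z∘e')`
when `x` and `z` agree off both wire sets, and `0` otherwise. This is the matrix form of
`(A ⊗ I)(I ⊗ B) = A ⊗ B` (Nielsen–Chuang §2.1.7, eq. (2.45), p. 73). [folklore] -/
theorem placeGate_mul_placeGate_apply_of_disjoint {k' : ℕ} (e : Fin k ↪ Fin n)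
    (e' : Fin k' ↪ Fin n) (h : Disjoint (Set.range e) (Set.range e'))
    (U : Matrix (QReg k) (QReg k) R) (V : Matrix (QReg k') (QReg k') R) (x z : QReg n) :
    (placeGate e U * placeGate e' V) x z =
      if (∀ i, i ∉ Set.range e → i ∉ Set.range e' → x i = z i) then
        U (x ∘ e) (z ∘ e) * V (x ∘ e') (z ∘ e') else 0 := by
  classical
  -- the unique contributing intermediate register
  let y₀ : QReg n := fun i => if i ∈ Set.range e then z i else x i
  have hy₀_mem : ∀ i, i ∈ Set.range e → y₀ i = z i := fun i hi => if_pos hi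
  have hy₀_nmem : ∀ i, i ∉ Set.range e → y₀ i = x i := fun i hi => if_neg hi
  have hy₀e : y₀ ∘ e = z ∘ e := funext fun j => hy₀_mem _ (Set.mem_range_self j)
  have hy₀e' : y₀ ∘ e' = x ∘ e' := funext fun j =>
    hy₀_nmem _ fun hj => Set.disjoint_left.1 h hj (Set.mem_range_self j)
  rw [Matrix.mul_apply, Finset.sum_eq_single y₀]
  · rw [placeGate_apply, placeGate_apply, hy₀e, hy₀e']
    by_cases hxz : ∀ i, i ∉ Set.range e → i ∉ Set.range e' → x i = z i
    · rw [if_pos hxz, if_pos, if_pos]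
      · intro i hi'
        by_cases hi : i ∈ Set.range e
        · exact hy₀_mem i hi
        · rw [hy₀_nmem i hi]
          exact hxz i hi hi'
      · intro i hi
        exact (hy₀_nmem i hi).symm
    · rw [if_neg hxz]
      push Not at hxz
      obtain ⟨i, hi, hi', hne⟩ := hxz
      by_cases h1 : ∀ i, i ∉ Set.range e → x i = y₀ i
      · rw [if_pos h1, if_neg, mul_zero]
        intro h2
        exact hne ((h1 i hi).trans (h2 i hi'))
      · rw [if_neg h1, zero_mul]
  · -- every other intermediate register gives a vanishing summand
    intro y _ hy
    rw [placeGate_apply, placeGate_apply]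
    split_ifs with h1 h2
    · exfalso
      apply hy
      funext i
      by_cases hi : i ∈ Set.range e
      · rw [hy₀_mem i hi]
        exact h2 i fun hi' => Set.disjoint_left.1 h hi hi'
      · rw [hy₀_nmem i hi]
        exact (h1 i hi).symm
    · exact mul_zero _
    · exact zero_mul _
    · exact zero_mul _
  · intro hy₀
    exact absurd (Finset.mem_univ y₀) hy₀

/-- **Discharge of `placeGate_comm_of_disjoint`.** Gates placed on disjoint sets of wires commute:
by `placeGate_mul_placeGate_apply_of_disjoint` both products have `(x, z)` entry
`U (x∘e) (z∘e) · V (x∘e') (z∘e')` (resp. the same two factors swapped) when `x` and `z` agree off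
`range e ∪ range e'`, and `0` otherwise; commutativity of `R` finishes. This is the standard fact
that operators on distinct tensor factors commute, `(A ⊗ I)(I ⊗ B) = A ⊗ B = (I ⊗ B)(A ⊗ I)`
(Nielsen–Chuang §2.1.7, eq. (2.45), p. 73; used implicitly throughout the circuit model, §4.2–4.3).
[cite: NielsenChuang2010, §2.1.7 eq. (2.45) and §4.2] -/
theorem placeGate_comm_of_disjoint_holds : placeGate_comm_of_disjoint (R := R) (k := k) (n := n) := by
  intro k' e e' h U V
  ext x z
  rw [placeGate_mul_placeGate_apply_of_disjoint e e' h,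
    placeGate_mul_placeGate_apply_of_disjoint e' e h.symm, mul_comm (V _ _)]
  by_cases hc : ∀ i, i ∉ Set.range e → i ∉ Set.range e' → x i = z i
  · rw [if_pos hc, if_pos fun i hi' hi => hc i hi hi']
  · rw [if_neg hc, if_neg fun hc' => hc fun i hi hi' => hc' i hi' hi]

end placeGate

/-! ### Named gates -/

/-- The Hadamard gate `H = (1/√2) [[1, 1], [1, -1]]`. Named `hGate` because `Matrix.hadamard` is
Mathlib's entrywise product. (Nielsen–Chuang §1.3.1, §4.2.) [folklore] -/
noncomputable def hGate : Matrix (QReg 1) (QReg 1) ℂ :=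
  Matrix.of fun x y => if x 0 = true ∧ y 0 = true then -(1 / (Real.sqrt 2 : ℂ)) else 1 / (Real.sqrt 2 : ℂ)

/-- The phase gate `S = diag(1, i)`. (Nielsen–Chuang §4.2, Fig. 4.2.) [folklore] -/
noncomputable def sGate : Matrix (QReg 1) (QReg 1) ℂ :=
  Matrix.of fun x y => if x = y then (if x 0 = true then Complex.I else 1) else 0

/-- The `π/8` gate `T = diag(1, e^{iπ/4})`. (Nielsen–Chuang §4.2, Fig. 4.2.) [folklore] -/
noncomputable def tGate : Matrix (QReg 1) (QReg 1) ℂ :=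
  Matrix.of fun x y =>
    if x = y then (if x 0 = true then Complex.exp (Real.pi / 4 * Complex.I) else 1) else 0

/-- The Pauli `X` (NOT) gate `[[0, 1], [1, 0]]`. (Nielsen–Chuang §1.3.1.) [folklore] -/
noncomputable def pauliX : Matrix (QReg 1) (QReg 1) ℂ :=
  Matrix.of fun x y => if x 0 = y 0 then 0 else 1

/-- The Pauli `Z` gate `diag(1, -1)`. (Nielsen–Chuang §1.3.1.) [folklore] -/
noncomputable def pauliZ : Matrix (QReg 1) (QReg 1) ℂ :=
  Matrix.of fun x y => if x = y then (if x 0 = true then -1 else 1) else 0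

/-- The controlled-NOT gate on two wires, control = wire `0`, target = wire `1`:
`|c, t⟩ ↦ |c, t ⊕ c⟩`. (Nielsen–Chuang §1.3.2, §4.3.) [folklore] -/
noncomputable def cnot : Matrix (QReg 2) (QReg 2) ℂ :=
  Matrix.of fun x y => if x 0 = y 0 ∧ x 1 = (y 1 ^^ y 0) then 1 else 0

/-- The controlled-`Z` gate on two wires: `|c, t⟩ ↦ (-1)^{c t} |c, t⟩`. (Nielsen–Chuang §4.3.) [folklore] -/
noncomputable def cz : Matrix (QReg 2) (QReg 2) ℂ :=
  Matrix.of fun x y => if x = y then (if x 0 = true ∧ x 1 = true then -1 else 1) else 0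

/-- The Toffoli (CCNOT) gate on three wires, controls = wires `0, 1`, target = wire `2`:
`|a, b, t⟩ ↦ |a, b, t ⊕ ab⟩`. (Nielsen–Chuang §4.3.) [folklore] -/
noncomputable def toffoli : Matrix (QReg 3) (QReg 3) ℂ :=
  Matrix.of fun x y => if x 0 = y 0 ∧ x 1 = y 1 ∧ x 2 = (y 2 ^^ (y 0 && y 1)) then 1 else 0

/-- The Hadamard gate is unitary. (Nielsen–Chuang §2.1.5.) [cite: NielsenChuang2010, §2.1.5] -/
def hGate_mem_unitaryGroup : Prop :=
  hGate ∈ Matrix.unitaryGroup (QReg 1) ℂ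

/-- The phase gate is unitary. (Nielsen–Chuang §4.2.) [cite: NielsenChuang2010, §4.2] -/
def sGate_mem_unitaryGroup : Prop :=
  sGate ∈ Matrix.unitaryGroup (QReg 1) ℂ

/-- The `T` gate is unitary. (Nielsen–Chuang §4.2.) [cite: NielsenChuang2010, §4.2] -/
def tGate_mem_unitaryGroup : Prop :=
  tGate ∈ Matrix.unitaryGroup (QReg 1) ℂ

/-- The Pauli `X` gate is unitary. (Nielsen–Chuang §2.1.5.) [cite: NielsenChuang2010, §2.1.5] -/
def pauliX_mem_unitaryGroup : Prop :=
  pauliX ∈ Matrix.unitaryGroup (QReg 1) ℂ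

/-- The Pauli `Z` gate is unitary. (Nielsen–Chuang §2.1.5.) [cite: NielsenChuang2010, §2.1.5] -/
def pauliZ_mem_unitaryGroup : Prop :=
  pauliZ ∈ Matrix.unitaryGroup (QReg 1) ℂ

/-- The CNOT gate is unitary. (Nielsen–Chuang §1.3.2.) [cite: NielsenChuang2010, §1.3.2] -/
def cnot_mem_unitaryGroup : Prop :=
  cnot ∈ Matrix.unitaryGroup (QReg 2) ℂ

/-- The controlled-`Z` gate is unitary. (Nielsen–Chuang §4.3.) [cite: NielsenChuang2010, §4.3] -/
def cz_mem_unitaryGroup : Prop :=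
  cz ∈ Matrix.unitaryGroup (QReg 2) ℂ

/-- The Toffoli gate is unitary. (Nielsen–Chuang §4.3.) [cite: NielsenChuang2010, §4.3] -/
def toffoli_mem_unitaryGroup : Prop :=
  toffoli ∈ Matrix.unitaryGroup (QReg 3) ℂ

/-! ### Gate sets -/

/-- A quantum gate set: an alphabet `Op` of operation symbols, each with an arity (number of qubits
it acts on) and a matrix on that many qubits. Unitarity is the separate predicate
`QGateSet.IsUnitary`. (Nielsen–Chuang §4.5.) [folklore] -/
structure QGateSet where
  /-- The alphabet of gate symbols. -/
  Op : Type
  /-- The number of qubits each gate acts on. -/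
  arity : Op → ℕ
  /-- The matrix of each gate. -/
  mat : (g : Op) → Matrix (QReg (arity g)) (QReg (arity g)) ℂ

namespace QGateSet

/-- A gate set is unitary if every gate matrix is unitary. (Nielsen–Chuang §4.5.) [folklore] -/
def IsUnitary (G : QGateSet) : Prop := ∀ g, G.mat g ∈ Matrix.unitaryGroup (QReg (G.arity g)) ℂ

end QGateSet

/-- The gate symbols of the Clifford+T gate set `{H, S, T, CNOT}`.
(Boykin–Mor–Pulver–Roychowdhury–Vatan 1999; Nielsen–Chuang §4.5.3.) [cite: BoykinMorPulverRoychowdhuryVatan1999] -/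
inductive CliffordTOp
  | H
  | S
  | T
  | CNOT
  deriving DecidableEq, Fintype, Inhabited

/-- `CliffordTOp` is encodable (needed for uniformity of circuit families), via `Fin 4`. [folklore] -/
instance : Encodable CliffordTOp := Encodable.ofEquiv (Fin 4)
  { toFun := fun g => match g with | .H => 0 | .S => 1 | .T => 2 | .CNOT => 3
    invFun := fun i => match i with | 0 => .H | 1 => .S | 2 => .T | 3 => .CNOT
    left_inv := fun g => by cases g <;> rfl
    right_inv := fun i => by fin_cases i <;> rfl }

/-- The Clifford+T gate set `{H, S, T, CNOT}` (arities `1, 1, 1, 2`).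
(Boykin–Mor–Pulver–Roychowdhury–Vatan 1999; Nielsen–Chuang §4.5.3.) [cite: BoykinMorPulverRoychowdhuryVatan1999] -/
noncomputable def cliffordT : QGateSet where
  Op := CliffordTOp
  arity
    | .H => 1
    | .S => 1
    | .T => 1
    | .CNOT => 2
  mat
    | .H => hGate
    | .S => sGate
    | .T => tGate
    | .CNOT => cnot

/-- The gate symbols of the Toffoli+Hadamard gate set `{H, X, CNOT, TOF}`. (Shi 2003;
Aharonov 2003, *A simple proof that Toffoli and Hadamard are quantum universal*.) [cite: Shi2003] -/
inductive ToffoliHOp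
  | H
  | X
  | CNOT
  | TOF
  deriving DecidableEq, Fintype, Inhabited

/-- `ToffoliHOp` is encodable, via `Fin 4`. [folklore] -/
instance : Encodable ToffoliHOp := Encodable.ofEquiv (Fin 4)
  { toFun := fun g => match g with | .H => 0 | .X => 1 | .CNOT => 2 | .TOF => 3
    invFun := fun i => match i with | 0 => .H | 1 => .X | 2 => .CNOT | 3 => .TOF
    left_inv := fun g => by cases g <;> rfl
    right_inv := fun i => by fin_cases i <;> rfl }

/-- The Toffoli+Hadamard gate set `{H, X, CNOT, TOF}` (arities `1, 1, 2, 3`); computationally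
universal (dense in the real orthogonal group modulo encoding). (Shi 2003; Aharonov 2003.) [cite: Shi2003] -/
noncomputable def toffoliH : QGateSet where
  Op := ToffoliHOp
  arity
    | .H => 1
    | .X => 1
    | .CNOT => 2
    | .TOF => 3
  mat
    | .H => hGate
    | .X => pauliX
    | .CNOT => cnot
    | .TOF => toffoli

/-- The Clifford+T gate set is unitary. (Nielsen–Chuang §4.5.3.) [folklore] -/
def cliffordT_isUnitary : Prop :=
  cliffordT.IsUnitary

/- interim proof relied on results that are now named facts (D-0014); demoted to a fact by the M5 import, proof preserved:
:= by
  rintro (_ | _ | _ | _)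
  · exact hGate_mem_unitaryGroup
  · exact sGate_mem_unitaryGroup
  · exact tGate_mem_unitaryGroup
  · exact cnot_mem_unitaryGroup
-/

/-- The Toffoli+Hadamard gate set is unitary. (Shi 2003.) [cite: Shi2003] -/
def toffoliH_isUnitary : Prop :=
  toffoliH.IsUnitary

/- interim proof relied on results that are now named facts (D-0014); demoted to a fact by the M5 import, proof preserved:
:= by
  rintro (_ | _ | _ | _)
  · exact hGate_mem_unitaryGroup
  · exact pauliX_mem_unitaryGroup
  · exact cnot_mem_unitaryGroup
  · exact toffoli_mem_unitaryGroup
-/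

/-! ### Placements and universality -/

/-- The set of all placements `placeGate e (G.mat g)` of gates of `G` on an `n`-qubit register.
(Nielsen–Chuang §4.5.) [folklore] -/
def placements (G : QGateSet) (n : ℕ) : Set (Matrix (QReg n) (QReg n) ℂ) :=
  {M | ∃ (g : G.Op) (e : Fin (G.arity g) ↪ Fin n), M = placeGate e (G.mat g)}

/-- A set `S` of `n`-qubit matrices *generates the unitary group densely modulo phase* if the
subgroup of `U(2^n)` generated by the unitary elements of `S` together with all global phases
`c • 1` is dense in `U(2^n)`. (Nielsen–Chuang §4.5.3; Boykin et al. 1999.) [cite: BoykinEtAl1999] -/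
def GeneratesDenselyModPhase (n : ℕ) (S : Set (Matrix (QReg n) (QReg n) ℂ)) : Prop :=
  Dense ((Subgroup.closure
    {U : Matrix.unitaryGroup (QReg n) ℂ | U.1 ∈ S ∨ ∃ c : ℂ, U.1 = c • (1 : Matrix _ _ ℂ)}) :
      Set (Matrix.unitaryGroup (QReg n) ℂ))

namespace QGateSet

/-- **Universality of a gate set (placement level).** `G` is universal if for all sufficiently
large `n` the placements of its gates on `n` wires generate a dense subgroup of `U(2^n)` modulo
global phase. (Nielsen–Chuang §4.5; Boykin–Mor–Pulver–Roychowdhury–Vatan 1999.)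

This notion is DIFFERENT from the accepted `Literature.Computability.QuantumComplexity.IsUniversalGateSet` (Wave0), which
concerns words over a fixed set inside a fixed `Matrix.specialUnitaryGroup (Fin n) ℂ` and cannot
express placements of few-qubit gates on varying registers. The expected bridge
(`IsUniversal G →` `IsUniversalGateSet` of the `SU`-projections of `placements G n`) is a remark
only and is not claimed here. [cite: BoykinMorPulverRoychowdhuryVatan1999] -/
def IsUniversal (G : QGateSet) : Prop :=
  ∃ n₀ : ℕ, ∀ n ≥ n₀, GeneratesDenselyModPhase n (placements G n)

/-- A gate set is inverse-closed if the inverse of every placement is a (finite, possibly empty)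
product of placements: for every `M ∈ placements G n` there is a list of placements whose product
is a left inverse of `M`. This is what the Solovay–Kitaev theorem requires of a gate set.
(Nielsen–Chuang App. 3; Dawson–Nielsen 2006.) [cite: DawsonNielsen2006] -/
def IsInverseClosed (G : QGateSet) : Prop :=
  ∀ n, ∀ M ∈ placements G n, ∃ l : List (Matrix (QReg n) (QReg n) ℂ),
    (∀ N ∈ l, N ∈ placements G n) ∧ l.prod * M = 1

/-- Every placement of a gate of a unitary gate set is unitary. [folklore] -/
def placements_subset_unitaryGroup : Prop :=
  ∀ {G : QGateSet} (hG : G.IsUnitary) (n : ℕ),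
    placements G n ⊆ (Matrix.unitaryGroup (QReg n) ℂ : Set (Matrix (QReg n) (QReg n) ℂ))

/- interim proof relied on results that are now named facts (D-0014); demoted to a fact by the M5 import, proof preserved:
:= by
  rintro M ⟨g, e, rfl⟩
  exact placeGate_mem_unitaryGroup e (hG g)
-/

end QGateSet

end Literature.Computability.Cryptography
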